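import Literature.MathematicalPhysics.QuantumFieldTheory.Balaban1983to89.B9Eq343CovariantResolventHolderLetters
import Literature.MathematicalPhysics.QuantumFieldTheory.Balaban1983to89.B9Eq344CovariantHessianRowTower

/-!
# `Balaban1983to89.B9Eq344HessianSliceTwoBackgroundLetters` — T. Bałaban, *Propagators for lattice gauge theories in a background field*, Commun. Math. Phys. **99** (1985)
# 389–434 [Balaban1985BackgroundPropagators] Thm 3.1 (3.43)–(3.44) p. 398 with (3.40) p. 397 (the η-scale Hölder norms), (3.3) p. 391, (3.8) p. 392, (3.35) p. 396, Thm 3.4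
# p. 400 with (3.60)–(3.65) pp. 402–403: **THE POINTWISE LETTERS OF THE TWO-BACKGROUND SLICE IDENTITY IN THE `cosh`-WEIGHTED CURRENCY** — for generic transporters on a torus
# (`‖R(b)w − w‖ ≤ ε‖w‖`, the Lipschitz letter `‖R(y,κ)w − R(y′,κ)w‖ ≤ ε_L·d(y,y′)·‖w‖`, `R₁` pointwise trivial): (i) the two-point row of a site field from its value and
# covariant-gradient rows (the path lemma `B9Eq340HolderRowOfGradientRow`); (ii) sup letters of `(D_{R₁} − D_R)v`, of `(D*_{S₁} − D*_S)X`, of `A_ω` and of `A_ω − A₁`; (iii) the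
# two-point letters of `(D_{R₁} − D_R)v` and of `A_ω − A₁` along parallel bonds; (iv) under the tower scaling `‖c‖ = K = L^{n+1}`, `‖c‖ε ≤ θ`, `K²ε_L ≤ dθ`, `ε ≤ θ`,
# `e^a, e^{adK} ≤ 3` (at the tower `θ = 2M_φM_φ′·α`): the SUP ROW `3(θM_w + θN + N′)` and the η-HÖLDER ROW `(9dθ(M_h + θM_w) + 3dθM_w + 9dθN + 3θH_ω + 3H′)·(d(y,y′)∕K)^{½}`
# of the Hölder data `B = (D_{R₁} − D_R)w + (A_ω − A₁)` of `B9Eq344HessianSliceTwoBackgroundIdentity` — every one-background row carries the small factor `θ`; only the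
# two-background rows `N′`, `H′` of `ω − ω₁` enter bare.  The inputs of the flat (3.44)-letter in the next file.  NE9 crux-team LEAF PROVER 01, gen 103.

statement-level skeleton of published theorems with citation tags; proofs where landed; nothing here is a claim about the Yang–Mills mass gap

CITATION HEADER (lean-in-tree rule).  Audit cell `pub-balaban`, sub-cell `t4`, BINDER row NE9; filed by NE9 crux-team LEAF PROVER 01 (`b2b-balaban-t4-ne9-formalise-leaf-01`,
gen 103; bears_on: R4/N22).  Source READ first-hand (`paper:balaban1985-cmp99-background-propagators`, pp. 391–392, 396–398, 400, 402–403).  REUSED BY NAME: gen 93's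
`B9Eq343CovariantResolventHolderLetters.weight_le_exp_mul_of_tdist_le`, `B9Eq340HolderRowOfGradientRow.norm_sub_le_of_step_bound`, `B9Eq342GradientRowNaturalPerturbation.
weight_site_{shift,unshift}_le`, `B9Eq342CoshWeightSite.weight_site_pos`, gen 95's `B9Eq344CovariantHessianRowTower.tdist_shift_shift`.  [folklore] triangle inequalities and
lattice paths; NOTHING of print's proofs is reproduced.  Nothing printed is a hypothesis.

WHAT IS PROVED (sorry-free; proof lane — 0 `def`; the weight `Wt` pinned by an equation).
* §3 `div_le_sqrt_div`, `covDeriv_trivial_sub_covDeriv_apply`, `covDiv_trivial_sub_covDiv_apply`, `norm_covDiv_trivial_sub_covDiv_apply_le`, `norm_smul_sub_transport_apply_le`,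
  **`norm_sub_le_of_value_and_gradRow`**, `norm_smul_sub_transport_sub_le`, `norm_Adiff_apply_le`, `norm_Adiff_sub_le`, `norm_A_apply_le`.
* §4 **`supRow_sliceB`**, **`holderRow_sliceB`** — the two rows of `B` under the tower scaling.
HONEST SCOPE.  Letters only ([folklore]); NOT summit progress (cell pub-balaban: NE9 NOT PRINTED ∕ NOT PROVED; «NE9 ⇐ the named binders»; row WALLED ON A MODEL (O-NE9-1;
#5 UNRULED); spine PROVED 0∕9; rung (B)+1 finite T⁴ — NOT infinite volume, NOT mass gap, NOT BetaPertH, NOT Clay).  HONEST DEPENDENCY: continuum YM on T⁴ ⇐ BetaPertH ∧ nine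
spine estimates (0/9 proved); BetaPertH ⇐ (D1) ∧ (D4) ∧ CAP+tail; G-an2-4 gates asym, D1 and NE2/3/4.  NEW file; nothing modified.  Net new unproved facts: 0.
-/


noncomputable section

open scoped BigOperators InnerProductSpace

namespace Literature.MathematicalPhysics.QuantumFieldTheory.Balaban1983to89.B9Eq344HessianSliceTwoBackgroundLetters

open B4Sect5Torus (TSite tdist tdist_nonneg tdist_symm)
open B4TorusKernel.MultiPeriod (circAbs)
open B9SectCLatticeCarrier (Bond bpos btgt shift unshift)
open B9Eq33CovDerivVector (covDeriv covDiv covDeriv_apply covDeriv_apply_dir covDiv_apply)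

/-! ## §3 Pointwise letters in the `cosh`-weighted currency (generic torus, generic transporters) -/

section Letters

variable {d : ℕ} {P : Fin d → ℕ} [∀ i, NeZero (P i)] {W : Type*} [NormedAddCommGroup W] [InnerProductSpace ℂ W]

open B9Eq343CovariantResolventHolderLetters (weight_le_exp_mul_of_tdist_le)
open B9Eq342GradientRowNaturalPerturbation (weight_site_shift_le weight_site_unshift_le)
open B9Eq342CoshWeightSite (weight_site_pos)
open B9Eq340HolderRowOfGradientRow (norm_sub_le_of_step_bound)
open B9Eq344CovariantHessianRowTower (tdist_shift_shift)

/-- `r∕ℓ ≤ (r∕ℓ)^{½}` for `0 ≤ r ≤ ℓ`, `0 < ℓ`. [folklore] -/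
private theorem div_le_sqrt_div {r ℓ : ℝ} (hr : 0 ≤ r) (hrl : r ≤ ℓ) (hl : 0 < ℓ) : r / ℓ ≤ (r / ℓ) ^ ((1 : ℝ) / 2) := by
  rcases hr.eq_or_lt with h | h
  · rw [← h, zero_div, Real.zero_rpow (by norm_num)]
  · have h1 : r / ℓ ≤ 1 := (div_le_one hl).2 hrl
    have h2 := Real.rpow_le_rpow_of_exponent_ge (div_pos h hl) h1 (by norm_num : (1 : ℝ) / 2 ≤ 1)
    rwa [Real.rpow_one] at h2

omit [∀ i, NeZero (P i)] in
/-- **`(D_{R₁} − D_R)v` POINTWISE for a pointwise-trivial `R₁`**: `(D_{R₁}v)(b) − (D_Rv)(b) = c•(v(b₊) − R(b)v(b₊))`. [folklore]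
[cite: Balaban1985BackgroundPropagators, (3.3) p.391] -/
theorem covDeriv_trivial_sub_covDeriv_apply (c : ℂ) (R R₁ : Bond d P → W →ₗ[ℂ] W) (hR₁ : ∀ b w, R₁ b w = w) (v : TSite d P → W) (b : Bond d P) :
    covDeriv c R₁ v b - covDeriv c R v b = c • (v (btgt b) - R b (v (btgt b))) := by
  rw [covDeriv_apply, covDeriv_apply, hR₁, ← smul_sub]
  congr 1
  abel

omit [∀ i, NeZero (P i)] in
/-- **`(D*_{S₁} − D*_S)X` POINTWISE for a pointwise-trivial `S₁`**: `(D*_{S₁}X)(x) − (D*_SX)(x) = c•Σ_μ(X(x−e_μ,μ) − S(x−e_μ,μ)X(x−e_μ,μ))`. [folklore]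
[cite: Balaban1985BackgroundPropagators, (3.8) p.392] -/
theorem covDiv_trivial_sub_covDiv_apply (c : ℂ) (S S₁ : Bond d P → W →ₗ[ℂ] W) (hS₁ : ∀ b w, S₁ b w = w) (X : Bond d P → W) (x : TSite d P) :
    covDiv c S₁ X x - covDiv c S X x = c • ∑ μ, (X (unshift μ x, μ) - S (unshift μ x, μ) (X (unshift μ x, μ))) := by
  rw [covDiv_apply, covDiv_apply, ← smul_sub, ← Finset.sum_sub_distrib]
  congr 1
  refine Finset.sum_congr rfl fun μ _ => ?_
  rw [hS₁]
  abel

/-- **SUP LETTER of `(D*_{S₁} − D*_S)X`**: `‖((D*_{S₁} − D*_S)X)(x)‖ ≤ ‖c‖·ε·d·M_X·e^a·W_{x₀}(x)` for `‖S(b)w − w‖ ≤ ε‖w‖`, `‖X(b)‖ ≤ M_X·W_{x₀}(b₋)`. [folklore]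
[cite: Balaban1985BackgroundPropagators, (3.8) p.392, (3.35) p.396] -/
theorem norm_covDiv_trivial_sub_covDiv_apply_le {a : ℝ} (ha : 0 ≤ a) (x₀ : TSite d P) (Wt : TSite d P → ℝ)
    (hWt : ∀ y, Wt y = ∏ μ, Real.cosh (a * (circAbs (P μ) ((((x₀ μ : ℕ) : ZMod (P μ)) - ((y μ : ℕ) : ZMod (P μ))).val) : ℝ)))
    (c : ℂ) (S S₁ : Bond d P → W →ₗ[ℂ] W) (hS₁ : ∀ b w, S₁ b w = w) {ε : ℝ} (hε : 0 ≤ ε) (hSε : ∀ b w, ‖S b w - w‖ ≤ ε * ‖w‖)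
    (X : Bond d P → W) {MX : ℝ} (hMX : 0 ≤ MX) (hX : ∀ b, ‖X b‖ ≤ MX * Wt (bpos b)) (x : TSite d P) :
    ‖covDiv c S₁ X x - covDiv c S X x‖ ≤ ‖c‖ * (ε * d * MX * Real.exp a) * Wt x := by
  rw [covDiv_trivial_sub_covDiv_apply c S S₁ hS₁, norm_smul]
  have hW0 : 0 ≤ Wt x := by rw [hWt]; exact (weight_site_pos P a x₀ x).le
  rw [mul_assoc]
  refine mul_le_mul_of_nonneg_left ?_ (norm_nonneg c)
  calc ‖∑ μ, (X (unshift μ x, μ) - S (unshift μ x, μ) (X (unshift μ x, μ)))‖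
      ≤ ∑ μ, ‖X (unshift μ x, μ) - S (unshift μ x, μ) (X (unshift μ x, μ))‖ := norm_sum_le _ _
    _ ≤ ∑ _μ : Fin d, ε * MX * Real.exp a * Wt x := Finset.sum_le_sum fun μ _ => by
        rw [norm_sub_rev]
        refine (hSε _ _).trans ?_
        have hu : Wt (unshift μ x) ≤ Real.exp a * Wt x := by rw [hWt, hWt]; exact weight_site_unshift_le ha x₀ x μ
        calc ε * ‖X (unshift μ x, μ)‖ ≤ ε * (MX * Wt (unshift μ x)) := mul_le_mul_of_nonneg_left (hX _) hε
          _ ≤ ε * (MX * (Real.exp a * Wt x)) := by gcongr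
          _ = ε * MX * Real.exp a * Wt x := by ring
    _ = ε * d * MX * Real.exp a * Wt x := by rw [Finset.sum_const, Finset.card_univ, Fintype.card_fin, nsmul_eq_mul]; ring

/-- **SUP LETTER of `c•(v(b₊) − R(b)v(b₊))`** (the piece `(D_{R₁} − D_R)v`): `≤ ‖c‖·ε·M_v·e^a·W_{x₀}(b₋)`. [folklore]
[cite: Balaban1985BackgroundPropagators, (3.3) p.391, (3.35) p.396] -/
theorem norm_smul_sub_transport_apply_le {a : ℝ} (ha : 0 ≤ a) (x₀ : TSite d P) (Wt : TSite d P → ℝ)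
    (hWt : ∀ y, Wt y = ∏ μ, Real.cosh (a * (circAbs (P μ) ((((x₀ μ : ℕ) : ZMod (P μ)) - ((y μ : ℕ) : ZMod (P μ))).val) : ℝ)))
    (c : ℂ) (R : Bond d P → W →ₗ[ℂ] W) {ε : ℝ} (hε : 0 ≤ ε) (hRε : ∀ b w, ‖R b w - w‖ ≤ ε * ‖w‖)
    (v : TSite d P → W) {Mv : ℝ} (hMv : 0 ≤ Mv) (hv : ∀ y, ‖v y‖ ≤ Mv * Wt y) (b : Bond d P) :
    ‖c • (v (btgt b) - R b (v (btgt b)))‖ ≤ ‖c‖ * (ε * Mv * Real.exp a) * Wt (bpos b) := by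
  rw [norm_smul, norm_sub_rev]
  rw [mul_assoc]
  refine mul_le_mul_of_nonneg_left ((hRε _ _).trans ?_) (norm_nonneg c)
  have hs : Wt (btgt b) ≤ Real.exp a * Wt (bpos b) := by rw [hWt, hWt]; exact weight_site_shift_le ha x₀ (bpos b) b.2
  calc ε * ‖v (btgt b)‖ ≤ ε * (Mv * Wt (btgt b)) := mul_le_mul_of_nonneg_left (hv _) hε
    _ ≤ ε * (Mv * (Real.exp a * Wt (bpos b))) := by gcongr
    _ = ε * Mv * Real.exp a * Wt (bpos b) := by ring

/-- **THE TWO-POINT ROW OF A SITE FIELD FROM ITS VALUE AND COVARIANT-GRADIENT ROWS** (`c ≠ 0`, `‖R(b)w − w‖ ≤ ε‖w‖`): with `r = d(y,y′)`,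
`‖v(y′) − v(y)‖ ≤ d·r·(‖c‖⁻¹M_∇ + εM_v)·e^{a·d·r}·W_{x₀}(y)` — each lattice step `v(p + e_μ) − v(p) = c⁻¹(D_Rv)(p,μ) − (R(p,μ) − 1)v(p + e_μ)` inside the sup-ball, then the path lemma
`B9Eq340HolderRowOfGradientRow.norm_sub_le_of_step_bound`. [folklore] [cite: Balaban1985BackgroundPropagators, (3.40) p.397, (3.3) p.391] -/
theorem norm_sub_le_of_value_and_gradRow {a : ℝ} (ha : 0 ≤ a) (x₀ : TSite d P) (Wt : TSite d P → ℝ)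
    (hWt : ∀ y, Wt y = ∏ μ, Real.cosh (a * (circAbs (P μ) ((((x₀ μ : ℕ) : ZMod (P μ)) - ((y μ : ℕ) : ZMod (P μ))).val) : ℝ)))
    (c : ℂ) (hc : c ≠ 0) (R : Bond d P → W →ₗ[ℂ] W) {ε : ℝ} (hε : 0 ≤ ε) (hRε : ∀ b w, ‖R b w - w‖ ≤ ε * ‖w‖)
    (v : TSite d P → W) {Mv Mg : ℝ} (hMv : 0 ≤ Mv) (hMg : 0 ≤ Mg) (hv : ∀ y, ‖v y‖ ≤ Mv * Wt y) (hg : ∀ b, ‖covDeriv c R v b‖ ≤ Mg * Wt (bpos b))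
    (y y' : TSite d P) :
    ‖v y' - v y‖ ≤ d * tdist P y y' * ((‖c‖⁻¹ * Mg + ε * Mv) * Real.exp (a * d * tdist P y y') * Wt y) := by
  have hP : ∀ i, 1 ≤ P i := fun i => Nat.one_le_iff_ne_zero.mpr (NeZero.ne (P i))
  have hW0 : 0 ≤ Wt y := by rw [hWt]; exact (weight_site_pos P a x₀ y).le
  set r : ℝ := tdist P y y' with hr
  refine norm_sub_le_of_step_bound hP v y y' (by positivity) fun p μ hp hp' => ?_
  have hWp : Wt p ≤ Real.exp (a * d * r) * Wt y := by rw [hWt, hWt]; exact weight_le_exp_mul_of_tdist_le ha x₀ y p hp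
  have hWp' : Wt (shift μ p) ≤ Real.exp (a * d * r) * Wt y := by rw [hWt, hWt]; exact weight_le_exp_mul_of_tdist_le ha x₀ y (shift μ p) hp'
  have hstep : v (shift μ p) - v p = c⁻¹ • covDeriv c R v (p, μ) - (R (p, μ) (v (shift μ p)) - v (shift μ p)) := by
    rw [covDeriv_apply_dir, smul_smul, inv_mul_cancel₀ hc, one_smul]
    abel
  rw [hstep]
  calc ‖c⁻¹ • covDeriv c R v (p, μ) - (R (p, μ) (v (shift μ p)) - v (shift μ p))‖
      ≤ ‖c⁻¹ • covDeriv c R v (p, μ)‖ + ‖R (p, μ) (v (shift μ p)) - v (shift μ p)‖ := norm_sub_le _ _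
    _ ≤ ‖c‖⁻¹ * (Mg * (Real.exp (a * d * r) * Wt y)) + ε * (Mv * (Real.exp (a * d * r) * Wt y)) := by
        refine add_le_add ?_ ?_
        · rw [norm_smul, norm_inv]
          exact mul_le_mul_of_nonneg_left ((hg (p, μ)).trans (mul_le_mul_of_nonneg_left hWp hMg)) (inv_nonneg.2 (norm_nonneg _))
        · exact (hRε _ _).trans (mul_le_mul_of_nonneg_left ((hv _).trans (mul_le_mul_of_nonneg_left hWp' hMv)) hε)
    _ = (‖c‖⁻¹ * Mg + ε * Mv) * Real.exp (a * d * r) * Wt y := by ring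

omit [∀ i, NeZero (P i)] in
/-- **TWO-POINT LETTER of `c•(v(b₊) − R(b)v(b₊))` ALONG PARALLEL BONDS `(y,κ)`, `(y′,κ)`**: with a Lipschitz transporter `‖R(y,κ)w − R(y′,κ)w‖ ≤ ε_L·d(y,y′)·‖w‖`,
`‖c•(v(y′+e_κ) − R(y′,κ)v(y′+e_κ)) − c•(v(y+e_κ) − R(y,κ)v(y+e_κ))‖ ≤ ‖c‖·(ε·‖v(y′+e_κ) − v(y+e_κ)‖ + ε_L·d(y,y′)·‖v(y+e_κ)‖)`. [folklore]
[cite: Balaban1985BackgroundPropagators, (3.3) p.391, (3.35) p.396, (3.40) p.397] -/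
theorem norm_smul_sub_transport_sub_le (c : ℂ) (R : Bond d P → W →ₗ[ℂ] W) {ε εL : ℝ} (hRε : ∀ b w, ‖R b w - w‖ ≤ ε * ‖w‖)
    (hRL : ∀ (y y' : TSite d P) (κ : Fin d) (w : W), ‖R (y, κ) w - R (y', κ) w‖ ≤ εL * tdist P y y' * ‖w‖) (v : TSite d P → W) (y y' : TSite d P) (κ : Fin d) :
    ‖c • (v (shift κ y') - R (y', κ) (v (shift κ y'))) - c • (v (shift κ y) - R (y, κ) (v (shift κ y)))‖ ≤
      ‖c‖ * (ε * ‖v (shift κ y') - v (shift κ y)‖ + εL * tdist P y y' * ‖v (shift κ y)‖) := by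
  rw [← smul_sub, norm_smul]
  refine mul_le_mul_of_nonneg_left ?_ (norm_nonneg c)
  have e : v (shift κ y') - R (y', κ) (v (shift κ y')) - (v (shift κ y) - R (y, κ) (v (shift κ y))) =
      -(R (y', κ) (v (shift κ y') - v (shift κ y)) - (v (shift κ y') - v (shift κ y))) + (R (y, κ) (v (shift κ y)) - R (y', κ) (v (shift κ y))) := by
    rw [map_sub]; abel
  rw [e]
  refine (norm_add_le _ _).trans (add_le_add ?_ (hRL _ _ _ _))
  rw [norm_neg]
  exact hRε _ _

/-- **SUP LETTER of `A_ω − A₁`** (`A_ω(y,κ) = −δ_{κμ}R(y,μ)ω(y+e_μ)`, `A₁(y,κ) = −δ_{κμ}R₁ω₁(y+e_μ)`, `R₁` pointwise trivial): with `‖ω(y)‖ ≤ N·W_{x₀}(y)`,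
`‖ω(y) − ω₁(y)‖ ≤ N′·W_{x₀}(y)`: `‖(A_ω − A₁)(b)‖ ≤ (ε·N + N′)·e^a·W_{x₀}(b₋)`. [folklore] [cite: Balaban1985BackgroundPropagators, (3.44) p.398, (3.35) p.396] -/
theorem norm_Adiff_apply_le {a : ℝ} (ha : 0 ≤ a) (x₀ : TSite d P) (Wt : TSite d P → ℝ)
    (hWt : ∀ y, Wt y = ∏ μ, Real.cosh (a * (circAbs (P μ) ((((x₀ μ : ℕ) : ZMod (P μ)) - ((y μ : ℕ) : ZMod (P μ))).val) : ℝ)))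
    (R R₁ : Bond d P → W →ₗ[ℂ] W) (hR₁ : ∀ b w, R₁ b w = w) {ε : ℝ} (hε : 0 ≤ ε) (hRε : ∀ b w, ‖R b w - w‖ ≤ ε * ‖w‖)
    (ω ω₁ : TSite d P → W) {N N' : ℝ} (hN : 0 ≤ N) (hN' : 0 ≤ N') (hω : ∀ y, ‖ω y‖ ≤ N * Wt y) (hδ : ∀ y, ‖ω y - ω₁ y‖ ≤ N' * Wt y) (μ : Fin d)
    (b : Bond d P) :
    ‖((if b.2 = μ then -(R (b.1, μ) (ω (shift μ b.1))) else 0) - (if b.2 = μ then -(R₁ (b.1, μ) (ω₁ (shift μ b.1))) else 0) : W)‖ ≤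
      (ε * N + N') * Real.exp a * Wt (bpos b) := by
  have hW0 : 0 ≤ Wt (bpos b) := by rw [hWt]; exact (weight_site_pos P a x₀ _).le
  have h0 : 0 ≤ (ε * N + N') * Real.exp a * Wt (bpos b) := by positivity
  split_ifs with hκ
  · rw [hR₁]
    have hs : Wt (shift μ b.1) ≤ Real.exp a * Wt (bpos b) := by rw [hWt, hWt]; exact weight_site_shift_le ha x₀ (bpos b) μ
    have e : -(R (b.1, μ) (ω (shift μ b.1))) - -(ω₁ (shift μ b.1)) = -((R (b.1, μ) (ω (shift μ b.1)) - ω (shift μ b.1)) + (ω (shift μ b.1) - ω₁ (shift μ b.1))) := by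
      abel
    rw [e, norm_neg]
    calc ‖(R (b.1, μ) (ω (shift μ b.1)) - ω (shift μ b.1)) + (ω (shift μ b.1) - ω₁ (shift μ b.1))‖
        ≤ ε * ‖ω (shift μ b.1)‖ + N' * Wt (shift μ b.1) := (norm_add_le _ _).trans (add_le_add (hRε _ _) (hδ _))
      _ ≤ ε * (N * (Real.exp a * Wt (bpos b))) + N' * (Real.exp a * Wt (bpos b)) := by
          gcongr
          exact (hω _).trans (mul_le_mul_of_nonneg_left hs hN)
      _ = (ε * N + N') * Real.exp a * Wt (bpos b) := by ring
  · rw [sub_self, norm_zero]; exact h0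

/-- **TWO-POINT LETTER of `A_ω − A₁` ALONG PARALLEL BONDS** (`R₁` pointwise trivial, Lipschitz transporter): for `b = (y,κ)`, `b′ = (y′,κ)`,
`‖(A_ω − A₁)(b′) − (A_ω − A₁)(b)‖ ≤ ε_L·d(y,y′)·‖ω(y′+e_μ)‖ + ε·‖ω(y′+e_μ) − ω(y+e_μ)‖ + ‖(ω − ω₁)(y′+e_μ) − (ω − ω₁)(y+e_μ)‖`. [folklore]
[cite: Balaban1985BackgroundPropagators, (3.44) p.398, (3.35) p.396, (3.40) p.397] -/
theorem norm_Adiff_sub_le (R R₁ : Bond d P → W →ₗ[ℂ] W) (hR₁ : ∀ b w, R₁ b w = w) {ε εL : ℝ} (hε : 0 ≤ ε) (hεL : 0 ≤ εL)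
    (hRε : ∀ b w, ‖R b w - w‖ ≤ ε * ‖w‖) (hRL : ∀ (y y' : TSite d P) (κ : Fin d) (w : W), ‖R (y, κ) w - R (y', κ) w‖ ≤ εL * tdist P y y' * ‖w‖)
    (ω ω₁ : TSite d P → W) (μ : Fin d) (y y' : TSite d P) (κ : Fin d) :
    ‖(((if ((y', κ) : Bond d P).2 = μ then -(R (((y', κ) : Bond d P).1, μ) (ω (shift μ ((y', κ) : Bond d P).1))) else 0) -
        (if ((y', κ) : Bond d P).2 = μ then -(R₁ (((y', κ) : Bond d P).1, μ) (ω₁ (shift μ ((y', κ) : Bond d P).1))) else 0)) -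
      ((if ((y, κ) : Bond d P).2 = μ then -(R (((y, κ) : Bond d P).1, μ) (ω (shift μ ((y, κ) : Bond d P).1))) else 0) -
        (if ((y, κ) : Bond d P).2 = μ then -(R₁ (((y, κ) : Bond d P).1, μ) (ω₁ (shift μ ((y, κ) : Bond d P).1))) else 0)) : W)‖ ≤
      εL * tdist P y y' * ‖ω (shift μ y')‖ + ε * ‖ω (shift μ y') - ω (shift μ y)‖ +
        ‖(ω (shift μ y') - ω₁ (shift μ y')) - (ω (shift μ y) - ω₁ (shift μ y))‖ := by
  have h0 : 0 ≤ εL * tdist P y y' * ‖ω (shift μ y')‖ + ε * ‖ω (shift μ y') - ω (shift μ y)‖ +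
      ‖(ω (shift μ y') - ω₁ (shift μ y')) - (ω (shift μ y) - ω₁ (shift μ y))‖ := by
    have := tdist_nonneg P y y'; positivity
  dsimp only
  split_ifs with hκ
  · rw [hR₁, hR₁]
    have e : -(R (y', μ) (ω (shift μ y'))) - -(ω₁ (shift μ y')) - (-(R (y, μ) (ω (shift μ y))) - -(ω₁ (shift μ y))) =
        -((R (y', μ) (ω (shift μ y')) - R (y, μ) (ω (shift μ y'))) + ((R (y, μ) (ω (shift μ y') - ω (shift μ y))) - (ω (shift μ y') - ω (shift μ y))) +
          ((ω (shift μ y') - ω₁ (shift μ y')) - (ω (shift μ y) - ω₁ (shift μ y)))) := by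
      rw [map_sub]; abel
    rw [e, norm_neg]
    refine (norm_add_le _ _).trans (add_le_add ((norm_add_le _ _).trans (add_le_add ?_ (hRε _ _))) le_rfl)
    have h := hRL y' y μ (ω (shift μ y'))
    rwa [tdist_symm (fun i => Nat.one_le_iff_ne_zero.mpr (NeZero.ne (P i)))] at h
  · simpa using h0

/-- **SUP LETTER of `A_ω` ALONE** (`R` a contraction): `‖A_ω(b)‖ ≤ N·e^a·W_{x₀}(b₋)`. [folklore] [cite: Balaban1985BackgroundPropagators, (3.44) p.398] -/
theorem norm_A_apply_le {a : ℝ} (ha : 0 ≤ a) (x₀ : TSite d P) (Wt : TSite d P → ℝ)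
    (hWt : ∀ y, Wt y = ∏ μ, Real.cosh (a * (circAbs (P μ) ((((x₀ μ : ℕ) : ZMod (P μ)) - ((y μ : ℕ) : ZMod (P μ))).val) : ℝ)))
    (R : Bond d P → W →ₗ[ℂ] W) (hRn : ∀ b w, ‖R b w‖ ≤ ‖w‖) (ω : TSite d P → W) {N : ℝ} (hN : 0 ≤ N) (hω : ∀ y, ‖ω y‖ ≤ N * Wt y) (μ : Fin d) (b : Bond d P) :
    ‖(if b.2 = μ then -(R (b.1, μ) (ω (shift μ b.1))) else 0 : W)‖ ≤ N * Real.exp a * Wt (bpos b) := by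
  have hW0 : 0 ≤ Wt (bpos b) := by rw [hWt]; exact (weight_site_pos P a x₀ _).le
  split_ifs with hκ
  · rw [norm_neg]
    have hs : Wt (shift μ b.1) ≤ Real.exp a * Wt (bpos b) := by rw [hWt, hWt]; exact weight_site_shift_le ha x₀ (bpos b) μ
    calc ‖R (b.1, μ) (ω (shift μ b.1))‖ ≤ ‖ω (shift μ b.1)‖ := hRn _ _
      _ ≤ N * Wt (shift μ b.1) := hω _
      _ ≤ N * (Real.exp a * Wt (bpos b)) := mul_le_mul_of_nonneg_left hs hN
      _ = N * Real.exp a * Wt (bpos b) := by ring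
  · rw [norm_zero]; positivity

/-! ## §4 The rows of the η-Hölder data `B = (D_{R₁} − D_R)w + (A_ω − A₁)` of the two-background slice identity, under the tower scaling
(`‖c‖ = K = L^{n+1}`, `‖c‖·ε ≤ θ`, `K²·ε_L ≤ d·θ`, `ε ≤ θ`, `e^a ≤ 3`, `e^{a·d·K} ≤ 3`; `θ = 2M_φM_φ′·α` at the tower) -/

/-- **SUP ROW OF `B`**: `‖B(b)‖ ≤ 3(θM_w + θN + N′)·W_{x₀}(b₋)`. [folklore] [cite: Balaban1985BackgroundPropagators, Thm 3.1 (3.44) p.398, (3.35) p.396, Thm 3.4 p.400] -/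
theorem supRow_sliceB {a : ℝ} (ha : 0 ≤ a) (ha3 : Real.exp a ≤ 3) (x₀ : TSite d P) (Wt : TSite d P → ℝ)
    (hWt : ∀ y, Wt y = ∏ μ, Real.cosh (a * (circAbs (P μ) ((((x₀ μ : ℕ) : ZMod (P μ)) - ((y μ : ℕ) : ZMod (P μ))).val) : ℝ)))
    (c : ℂ) (R R₁ : Bond d P → W →ₗ[ℂ] W) (hR₁ : ∀ b w, R₁ b w = w) {ε θ : ℝ} (hε : 0 ≤ ε) (hθ : 0 ≤ θ) (hεθ : ε ≤ θ) (hcε : ‖c‖ * ε ≤ θ)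
    (hRε : ∀ b w, ‖R b w - w‖ ≤ ε * ‖w‖) (w ω ω₁ : TSite d P → W) {Mw N N' : ℝ} (hMw : 0 ≤ Mw) (hN : 0 ≤ N) (hN' : 0 ≤ N')
    (hw : ∀ y, ‖w y‖ ≤ Mw * Wt y) (hω : ∀ y, ‖ω y‖ ≤ N * Wt y) (hδ : ∀ y, ‖ω y - ω₁ y‖ ≤ N' * Wt y) (μ : Fin d) (b : Bond d P) :
    ‖c • (w (btgt b) - R b (w (btgt b))) +
        ((if b.2 = μ then -(R (b.1, μ) (ω (shift μ b.1))) else 0) - (if b.2 = μ then -(R₁ (b.1, μ) (ω₁ (shift μ b.1))) else 0))‖ ≤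
      3 * (θ * Mw + θ * N + N') * Wt (bpos b) := by
  have hW0 : 0 ≤ Wt (bpos b) := by rw [hWt]; exact (weight_site_pos P a x₀ _).le
  have h1 := norm_smul_sub_transport_apply_le ha x₀ Wt hWt c R hε hRε w hMw hw b
  have h2 := norm_Adiff_apply_le ha x₀ Wt hWt R R₁ hR₁ hε hRε ω ω₁ hN hN' hω hδ μ b
  refine (norm_add_le _ _).trans ((add_le_add h1 h2).trans ?_)
  have e1 : ‖c‖ * (ε * Mw * Real.exp a) * Wt (bpos b) = (‖c‖ * ε) * (Mw * Real.exp a * Wt (bpos b)) := by ring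
  rw [e1]
  have h3 : (‖c‖ * ε) * (Mw * Real.exp a * Wt (bpos b)) ≤ θ * (Mw * 3 * Wt (bpos b)) :=
    mul_le_mul hcε (by gcongr) (by positivity) hθ
  have h4 : (ε * N + N') * Real.exp a * Wt (bpos b) ≤ (θ * N + N') * 3 * Wt (bpos b) := by gcongr
  nlinarith [h3, h4]

/-- **η-HÖLDER ROW OF `B` ALONG PARALLEL BONDS** (`d(y,y′) ≤ K`): with the value ∕ covariant-gradient rows `M_w`, `M_h` of `w`, the value ∕ η-Hölder rows `N`, `H_ω` of `ω` and the
η-Hölder row `H′` of `ω − ω₁`:  `‖B(y′,κ) − B(y,κ)‖ ≤ (9dθ(M_h + θM_w) + 3dθM_w + 9dθN + 3θH_ω + 3H′)·W_{x₀}(y)·(d(y,y′)∕K)^{½}` — every `w`- and `ω`-term carries the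
small factor `θ`; only the genuinely two-background datum `H′` enters bare. [folklore] [cite: Balaban1985BackgroundPropagators, Thm 3.1 (3.43)–(3.44) p.398, (3.40) p.397, (3.35) p.396, Thm 3.4 p.400] -/
theorem holderRow_sliceB {a : ℝ} (ha : 0 ≤ a) (ha3 : Real.exp a ≤ 3) {K : ℝ} (hK1 : 1 ≤ K) (haK : Real.exp (a * d * K) ≤ 3) (x₀ : TSite d P) (Wt : TSite d P → ℝ)
    (hWt : ∀ y, Wt y = ∏ μ, Real.cosh (a * (circAbs (P μ) ((((x₀ μ : ℕ) : ZMod (P μ)) - ((y μ : ℕ) : ZMod (P μ))).val) : ℝ)))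
    (c : ℂ) (hcK : ‖c‖ = K) (R R₁ : Bond d P → W →ₗ[ℂ] W) (hR₁ : ∀ b w, R₁ b w = w) {ε εL θ : ℝ} (hε : 0 ≤ ε) (hεL : 0 ≤ εL) (hθ : 0 ≤ θ)
    (hεθ : ε ≤ θ) (hcε : K * ε ≤ θ) (hεLK : K * K * εL ≤ d * θ) (hRε : ∀ b w, ‖R b w - w‖ ≤ ε * ‖w‖)
    (hRL : ∀ (y y' : TSite d P) (κ : Fin d) (w : W), ‖R (y, κ) w - R (y', κ) w‖ ≤ εL * tdist P y y' * ‖w‖)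
    (w ω ω₁ : TSite d P → W) {Mw Mh N Hω H' : ℝ} (hMw : 0 ≤ Mw) (hMh : 0 ≤ Mh) (hN : 0 ≤ N) (hHω : 0 ≤ Hω) (hH' : 0 ≤ H')
    (hw : ∀ y, ‖w y‖ ≤ Mw * Wt y) (hwg : ∀ b, ‖covDeriv c R w b‖ ≤ Mh * Wt (bpos b)) (hω : ∀ y, ‖ω y‖ ≤ N * Wt y)
    (hωH : ∀ y y', tdist P y y' ≤ K → ‖ω y' - ω y‖ ≤ Hω * Wt y * (tdist P y y' / K) ^ ((1 : ℝ) / 2))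
    (hδH : ∀ y y', tdist P y y' ≤ K → ‖(ω y' - ω₁ y') - (ω y - ω₁ y)‖ ≤ H' * Wt y * (tdist P y y' / K) ^ ((1 : ℝ) / 2))
    (μ : Fin d) (y y' : TSite d P) (κ : Fin d) (hyy : tdist P y y' ≤ K) :
    ‖(c • (w (btgt ((y', κ) : Bond d P)) - R (y', κ) (w (btgt ((y', κ) : Bond d P)))) +
        ((if ((y', κ) : Bond d P).2 = μ then -(R (((y', κ) : Bond d P).1, μ) (ω (shift μ ((y', κ) : Bond d P).1))) else 0) -
          (if ((y', κ) : Bond d P).2 = μ then -(R₁ (((y', κ) : Bond d P).1, μ) (ω₁ (shift μ ((y', κ) : Bond d P).1))) else 0))) -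
      (c • (w (btgt ((y, κ) : Bond d P)) - R (y, κ) (w (btgt ((y, κ) : Bond d P)))) +
        ((if ((y, κ) : Bond d P).2 = μ then -(R (((y, κ) : Bond d P).1, μ) (ω (shift μ ((y, κ) : Bond d P).1))) else 0) -
          (if ((y, κ) : Bond d P).2 = μ then -(R₁ (((y, κ) : Bond d P).1, μ) (ω₁ (shift μ ((y, κ) : Bond d P).1))) else 0)))‖ ≤
      (9 * d * θ * (Mh + θ * Mw) + 3 * d * θ * Mw + 9 * d * θ * N + 3 * θ * Hω + 3 * H') * Wt y * (tdist P y y' / K) ^ ((1 : ℝ) / 2) := by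
  have hP : ∀ i, 1 ≤ P i := fun i => Nat.one_le_iff_ne_zero.mpr (NeZero.ne (P i))
  have hK0 : 0 < K := lt_of_lt_of_le one_pos hK1
  have hc0 : c ≠ 0 := by intro h; rw [h, norm_zero] at hcK; linarith
  have hd0 : (0 : ℝ) ≤ d := Nat.cast_nonneg d
  set r : ℝ := tdist P y y' with hr
  have hr0 : 0 ≤ r := tdist_nonneg _ _ _
  set sq : ℝ := (r / K) ^ ((1 : ℝ) / 2) with hsq
  have hsq0 : 0 ≤ sq := Real.rpow_nonneg (div_nonneg hr0 hK0.le) _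
  have hrs : r / K ≤ sq := div_le_sqrt_div hr0 hyy hK0
  -- weights
  have hWpos : ∀ z, 0 < Wt z := fun z => by rw [hWt]; exact weight_site_pos P a x₀ z
  have hW0 := (hWpos y).le
  have hEr : Real.exp (a * d * r) ≤ 3 := (Real.exp_le_exp.2 (mul_le_mul_of_nonneg_left hyy (by positivity))).trans haK
  have hWs : ∀ z ν, Wt (shift ν z) ≤ 3 * Wt z := fun z ν => by
    have h := weight_site_shift_le ha x₀ z ν; rw [← hWt, ← hWt] at h
    exact h.trans (mul_le_mul_of_nonneg_right ha3 (hWpos z).le)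
  have hWy' : Wt y' ≤ 3 * Wt y := by
    have h := weight_le_exp_mul_of_tdist_le ha x₀ y y' ((tdist_symm hP y' y).le : tdist P y' y ≤ r); rw [← hWt, ← hWt] at h
    exact h.trans (mul_le_mul_of_nonneg_right hEr hW0)
  have hW1 : Wt (shift κ y) ≤ 3 * Wt y := hWs y κ
  have hW2 : Wt (shift μ y) ≤ 3 * Wt y := hWs y μ
  have hW3 : Wt (shift μ y') ≤ 9 * Wt y := (hWs y' μ).trans (by linarith [hWy'])
  -- scaling letters
  have hεK : ε ≤ θ / K := by rw [le_div_iff₀ hK0, mul_comm]; exact hcε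
  have hεLK' : εL ≤ d * θ / (K * K) := by rw [le_div_iff₀ (by positivity)]; linarith [hεLK]
  have hKK : K ≤ K * K := by nlinarith
  -- regroup `(X′ + A′) − (X + A) = (X′ − X) + (A′ − A)`
  have e : ∀ X' A' X A : W, (X' + A') - (X + A) = (X' - X) + (A' - A) := fun _ _ _ _ => by abel
  rw [e]
  refine (norm_add_le _ _).trans ?_
  -- the `w`-piece
  have hX : ‖c • (w (btgt ((y', κ) : Bond d P)) - R (y', κ) (w (btgt ((y', κ) : Bond d P)))) -
      c • (w (btgt ((y, κ) : Bond d P)) - R (y, κ) (w (btgt ((y, κ) : Bond d P))))‖ ≤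
      (9 * d * θ * (Mh + θ * Mw) + 3 * d * θ * Mw) * Wt y * sq := by
    have h := norm_smul_sub_transport_sub_le c R hRε hRL w y y' κ
    have hhold := norm_sub_le_of_value_and_gradRow ha x₀ Wt hWt c hc0 R hε hRε w hMw hMh hw hwg (shift κ y) (shift κ y')
    rw [tdist_shift_shift hP] at hhold
    refine h.trans ?_
    rw [hcK]
    -- `K·ε·(d r (K⁻¹M_h + εM_w)E W⁺) + K·ε_L·r·M_w W⁺`
    have hA : ε * ‖w (shift κ y') - w (shift κ y)‖ ≤ (θ / K) * (d * r * ((K⁻¹ * Mh + (θ / K) * Mw) * 3 * (3 * Wt y))) := by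
      refine mul_le_mul hεK (hhold.trans ?_) (norm_nonneg _) (by positivity)
      have hWκ : 0 ≤ Wt (shift κ y) := (hWpos _).le
      have : (‖c‖⁻¹ * Mh + ε * Mw) * Real.exp (a * d * r) * Wt (shift κ y) ≤ (K⁻¹ * Mh + θ / K * Mw) * 3 * (3 * Wt y) := by
        rw [hcK]; gcongr
      exact mul_le_mul_of_nonneg_left this (by positivity)
    have hB : εL * tdist P y y' * ‖w (shift κ y)‖ ≤ (d * θ / (K * K)) * r * (Mw * (3 * Wt y)) := by
      refine mul_le_mul (mul_le_mul_of_nonneg_right hεLK' hr0) ((hw _).trans (mul_le_mul_of_nonneg_left hW1 hMw)) (norm_nonneg _) (by positivity)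
    calc K * (ε * ‖w (shift κ y') - w (shift κ y)‖ + εL * tdist P y y' * ‖w (shift κ y)‖)
        ≤ K * ((θ / K) * (d * r * ((K⁻¹ * Mh + (θ / K) * Mw) * 3 * (3 * Wt y))) + (d * θ / (K * K)) * r * (Mw * (3 * Wt y))) :=
          mul_le_mul_of_nonneg_left (add_le_add hA hB) hK0.le
      _ = (9 * d * θ * (Mh + θ * Mw) + 3 * d * θ * Mw) * Wt y * (r / K) := by field_simp; ring
      _ ≤ (9 * d * θ * (Mh + θ * Mw) + 3 * d * θ * Mw) * Wt y * sq := mul_le_mul_of_nonneg_left hrs (by positivity)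
  -- the `A`-piece
  have hAp : ‖((if ((y', κ) : Bond d P).2 = μ then -(R (((y', κ) : Bond d P).1, μ) (ω (shift μ ((y', κ) : Bond d P).1))) else 0) -
          (if ((y', κ) : Bond d P).2 = μ then -(R₁ (((y', κ) : Bond d P).1, μ) (ω₁ (shift μ ((y', κ) : Bond d P).1))) else 0)) -
        ((if ((y, κ) : Bond d P).2 = μ then -(R (((y, κ) : Bond d P).1, μ) (ω (shift μ ((y, κ) : Bond d P).1))) else 0) -
          (if ((y, κ) : Bond d P).2 = μ then -(R₁ (((y, κ) : Bond d P).1, μ) (ω₁ (shift μ ((y, κ) : Bond d P).1))) else 0))‖ ≤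
      (9 * d * θ * N + 3 * θ * Hω + 3 * H') * Wt y * sq := by
    refine (norm_Adiff_sub_le R R₁ hR₁ hε hεL hRε hRL ω ω₁ μ y y' κ).trans ?_
    have hyy' : tdist P (shift μ y) (shift μ y') ≤ K := by rw [tdist_shift_shift hP]; exact hyy
    have h1 : εL * tdist P y y' * ‖ω (shift μ y')‖ ≤ (d * θ / (K * K)) * r * (N * (9 * Wt y)) :=
      mul_le_mul (mul_le_mul_of_nonneg_right hεLK' hr0) ((hω _).trans (mul_le_mul_of_nonneg_left hW3 hN)) (norm_nonneg _) (by positivity)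
    have h2 : ε * ‖ω (shift μ y') - ω (shift μ y)‖ ≤ θ * (Hω * (3 * Wt y) * sq) := by
      refine mul_le_mul hεθ ((hωH _ _ hyy').trans ?_) (norm_nonneg _) hθ
      rw [tdist_shift_shift hP]; gcongr
    have h3 : ‖(ω (shift μ y') - ω₁ (shift μ y')) - (ω (shift μ y) - ω₁ (shift μ y))‖ ≤ H' * (3 * Wt y) * sq := by
      refine (hδH _ _ hyy').trans ?_
      rw [tdist_shift_shift hP]; gcongr
    have h1' : (d * θ / (K * K)) * r * (N * (9 * Wt y)) ≤ 9 * d * θ * N * Wt y * sq := by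
      have e1 : (d * θ / (K * K)) * r * (N * (9 * Wt y)) = 9 * d * θ * N * Wt y * (r / K) * K⁻¹ := by field_simp
      rw [e1]
      have hK' : K⁻¹ ≤ 1 := inv_le_one_of_one_le₀ hK1
      calc 9 * d * θ * N * Wt y * (r / K) * K⁻¹ ≤ 9 * d * θ * N * Wt y * sq * 1 := by gcongr
        _ = 9 * d * θ * N * Wt y * sq := mul_one _
    calc εL * tdist P y y' * ‖ω (shift μ y')‖ + ε * ‖ω (shift μ y') - ω (shift μ y)‖ +
          ‖(ω (shift μ y') - ω₁ (shift μ y')) - (ω (shift μ y) - ω₁ (shift μ y))‖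
        ≤ 9 * d * θ * N * Wt y * sq + θ * (Hω * (3 * Wt y) * sq) + H' * (3 * Wt y) * sq := add_le_add (add_le_add (h1.trans h1') h2) h3
      _ = (9 * d * θ * N + 3 * θ * Hω + 3 * H') * Wt y * sq := by ring
  refine (add_le_add hX hAp).trans (le_of_eq ?_)
  ring

end Letters

end Literature.MathematicalPhysics.QuantumFieldTheory.Balaban1983to89.B9Eq344HessianSliceTwoBackgroundLetters

end
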